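import Literature.Computability.Complexity.AlgebrizationBarriers
import Literature.Computability.QuantumComplexity.OracleSeparationBQPBPPAlgebraic
import HarnessLib

/-!
# Discharge of `aaronsonWigderson2009_bqp_not_subset_bpp` (the algebraic separation `BQP^A ⊄ BPP^Ã`)

Sibling proof file of `AlgebrizationBarriers.lean` (D-0014). It discharges the named fact

* `aaronsonWigderson2009_bqp_not_subset_bpp` — there are an oracle language `A` and a multilinear
  extension `Ã` of `A` (`Ã.IsExtensionOf A 1`) with `BQP^A ⊄ BPP^Ã`

(S. Aaronson, A. Wigderson, *Algebrization: a new barrier in complexity theory*, STOC 2008, full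
version Thm. 5.11 (v), p. 28 — in the journal version's table of results the `BQP`/`BPP` item; the
tree docstring says "(iv)": in the held full version item (iv) is `NP^A ⊄ BQP^Ã` and (v) is
`BQP^A ⊄ BPP^Ã`), unconditionally, from the assembly
`Literature.Computability.QuantumComplexity.exists_oracle_BQPRel_not_subset_BPPRel_multilinearExtension`
(`QuantumComplexity/OracleSeparationBQPBPPAlgebraic.lean`) with `Ã := multilinearExtension A`
(`multilinearExtension_isExtensionOf`).

## The proof (a different route than the printed sketch)

Aaronson–Wigderson's three-line sketch invokes Raz's exponential separation of quantum and
randomized *communication* complexity and their transfer principle (Thm. 4.11: a machine querying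
`Ã` is simulated by a protocol between Alice holding `A₀` and Bob holding `A₁`). The tree proves
the statement along the modern rigorous version of that route (Forrelation lifted by XOR,
Girish–Raz–Tal 2021), entirely inside the tree's models:

* quantum side (`RazTalMasked{Blocks,Machine,Uniform}.lean`): Raz–Tal's uniform `BQP^O` machine
  `Q₁` (the tree's `RazTal2022_bqpMachine` construction) run on the **XOR-masked** level-`n`
  window `x_n(i,k) = [rtAddr n i k ++ [0] ∈ A] ⊕ [rtAddr n i k ++ [1] ∈ A]`, two phase queries per
  block — the plain layout of Raz–Tal's Appendix A would be defeated by a `BPP` machine with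
  access to `Ã` (one extension query returns an exact sub-cube sum of a block);
* classical side: the transfer principle in rectangle form (`AlgebraicQueryRectangles.lean`:
  the acceptance of a `q`-round machine against `Ã` of the doubly patched oracle is constant on
  the parts of a partition of (mask, masked window) into `≤ (4^{B+1}+1)^{B+1}` rectangles), the
  Fourier growth `L_{1,k} ≤ (2e(ln K + 3))^k` of XOR-fibres of rectangle partitions
  (`XorFiberGrowth.lean`, from the level-`k` inequalities of `BonamiLevelK.lean`), Raz–Tal's
  Thm. 7.4 in its general Fourier-growth form (`abs_integral_truncEval_sub_le`) and the hybrid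
  over the blocks (`AlgebraicForrelationFooling.lean`, the analogue of Raz–Tal's Claim 8.2 for
  `BPP^Ã`), and the stage-wise diagonalization of Ko (1989) with double windows
  (`OracleSeparationBQPBPPAlgebraic.lean`, as the tree's `OracleSeparationBQPBPP.lean`).

## References

* S. Aaronson, A. Wigderson, *Algebrization: a new barrier in complexity theory*, STOC 2008 (full
  version), Thm. 5.11 (v) and its proof sketch p. 28, Thm. 4.11 p. 22, Def. 2.2–2.3
  [AaronsonWigderson2008]; journal version ACM TOCT 1 (2009) [AaronsonWigderson2009].
* R. Raz, A. Tal, *Oracle separation of BQP and PH*, J. ACM 69 (2022), §7, App. A [RazTalJACM2022].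
* U. Girish, R. Raz, A. Tal, *Quantum versus randomized communication complexity, with efficient
  players*, ITCS 2021 (LIPIcs 185) (XOR-lifted Forrelation).
* R. O'Donnell, *Analysis of Boolean Functions*, CUP 2014, Ch. 9 [ODonnell2014].
-/

namespace Literature.Computability.Complexity

open _root_.Computability Cryptography

/-- **Discharge of `aaronsonWigderson2009_bqp_not_subset_bpp`** (Aaronson–Wigderson, Thm. 5.11 (v)):
there are an oracle language `A` and a multilinear extension `Ã` of `A` with `BQP^A ⊄ BPP^Ã` —
`Ã := multilinearExtension A` for the oracle `A` of
`exists_oracle_BQPRel_not_subset_BPPRel_multilinearExtension`. [cite: AaronsonWigderson2008, Thm. 5.11 (v)] -/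
theorem aaronsonWigderson2009_bqp_not_subset_bpp_holds : aaronsonWigderson2009_bqp_not_subset_bpp := by
  obtain ⟨A, hA⟩ := Literature.Computability.QuantumComplexity.exists_oracle_BQPRel_not_subset_BPPRel_multilinearExtension
  exact ⟨A, multilinearExtension A, multilinearExtension_isExtensionOf A, hA⟩

end Literature.Computability.Complexity
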